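import Mathlib

/-!
# One-sided third-order Taylor bounds (comparison-function method)

Support lemmas for the kernel import of the top-block pairing inequality (`TopBlockPairingNeg 31`,
column SCREW, engine A): if `f‴ ≤ B` on `[c, b]` then
`f x ≤ f c + f′ c (x − c) + f″ c (x − c)²/2 + B (x − c)³/6` there, and the mirror statement left of
the centre.  Pure Mathlib calculus (`antitoneOn_of_deriv_nonpos` applied three times); no axioms
beyond the standard ones.  Nothing here bears on the truth of RH.
-/

set_option autoImplicit false
set_option linter.dupNamespace false

namespace Summit.RiemannHypothesis.RiemannHypothesis.Theorems.IntegerScrew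

open Set

/-- **One-sided third-order Taylor bound (right of the centre).**  If `f, f', f''` have derivatives
`f', f'', f'''` on `[c, b]` and `f''' ≤ B` there, then
`f x ≤ f c + f' c (x − c) + f'' c (x − c)²/2 + B (x − c)³/6` for `x ∈ [c, b]`. [folklore] -/
theorem taylor3_upper_right {f f' f'' f''' : ℝ → ℝ} {c b B : ℝ} (hcb : c ≤ b)
    (hf : ∀ x ∈ Icc c b, HasDerivAt f (f' x) x) (hf' : ∀ x ∈ Icc c b, HasDerivAt f' (f'' x) x)
    (hf'' : ∀ x ∈ Icc c b, HasDerivAt f'' (f''' x) x) (hB : ∀ x ∈ Icc c b, f''' x ≤ B)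
    {x : ℝ} (hx : x ∈ Icc c b) :
    f x ≤ f c + f' c * (x - c) + f'' c * (x - c) ^ 2 / 2 + B * (x - c) ^ 3 / 6 := by
  have hD : Convex ℝ (Icc c b) := convex_Icc c b
  have hint : interior (Icc c b) = Ioo c b := interior_Icc
  -- level 2: g₂ = f'' − f'' c − B (x − c) is antitone, hence ≤ 0
  set g₂ : ℝ → ℝ := fun x => f'' x - f'' c - B * (x - c) with hg₂
  have hg₂d : ∀ x ∈ Icc c b, HasDerivAt g₂ (f''' x - B) x := by
    intro x hx
    have h := ((hf'' x hx).sub_const (f'' c)).sub (((hasDerivAt_id x).sub_const c).const_mul B)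
    refine (h.congr_of_eventuallyEq (Filter.Eventually.of_forall fun y => ?_)).congr_deriv (by simp)
    simp only [hg₂, Pi.sub_apply, id]
  have hg₂anti : AntitoneOn g₂ (Icc c b) := by
    refine antitoneOn_of_deriv_nonpos hD ?_ ?_ ?_
    · exact fun x hx => (hg₂d x hx).continuousAt.continuousWithinAt
    · intro x hx; rw [hint] at hx
      exact (hg₂d x (Ioo_subset_Icc_self hx)).differentiableAt.differentiableWithinAt
    · intro x hx; rw [hint] at hx
      rw [(hg₂d x (Ioo_subset_Icc_self hx)).deriv]
      linarith [hB x (Ioo_subset_Icc_self hx)]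
  have hg₂le : ∀ x ∈ Icc c b, g₂ x ≤ 0 := by
    intro x hx
    have := hg₂anti (left_mem_Icc.2 hcb) hx hx.1
    simp only [hg₂, sub_self, mul_zero] at this ⊢
    linarith
  -- level 1: g₁ = f' − f' c − f'' c (x − c) − B (x − c)²/2 is antitone, hence ≤ 0
  set g₁ : ℝ → ℝ := fun x => f' x - f' c - f'' c * (x - c) - B * (x - c) ^ 2 / 2 with hg₁
  have hg₁d : ∀ x ∈ Icc c b, HasDerivAt g₁ (g₂ x) x := by
    intro x hx
    have h1 := ((hasDerivAt_id x).sub_const c).const_mul (f'' c)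
    have h2 := (((hasDerivAt_id x).sub_const c).pow 2).const_mul B |>.div_const 2
    have h := (((hf' x hx).sub_const (f' c)).sub h1).sub h2
    refine (h.congr_of_eventuallyEq (Filter.Eventually.of_forall fun y => ?_)).congr_deriv ?_
    · simp only [hg₁, Pi.sub_apply, Pi.pow_apply, id]
    · simp only [hg₂, id]; ring
  have hg₁anti : AntitoneOn g₁ (Icc c b) := by
    refine antitoneOn_of_deriv_nonpos hD ?_ ?_ ?_
    · exact fun x hx => (hg₁d x hx).continuousAt.continuousWithinAt
    · intro x hx; rw [hint] at hx
      exact (hg₁d x (Ioo_subset_Icc_self hx)).differentiableAt.differentiableWithinAt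
    · intro x hx; rw [hint] at hx
      rw [(hg₁d x (Ioo_subset_Icc_self hx)).deriv]
      exact hg₂le x (Ioo_subset_Icc_self hx)
  have hg₁le : ∀ x ∈ Icc c b, g₁ x ≤ 0 := by
    intro x hx
    have := hg₁anti (left_mem_Icc.2 hcb) hx hx.1
    simp only [hg₁, sub_self, mul_zero] at this ⊢
    norm_num at this
    linarith
  -- level 0
  set g₀ : ℝ → ℝ := fun x => f x - f c - f' c * (x - c) - f'' c * (x - c) ^ 2 / 2 - B * (x - c) ^ 3 / 6
    with hg₀
  have hg₀d : ∀ x ∈ Icc c b, HasDerivAt g₀ (g₁ x) x := by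
    intro x hx
    have h1 := ((hasDerivAt_id x).sub_const c).const_mul (f' c)
    have h2 := (((hasDerivAt_id x).sub_const c).pow 2).const_mul (f'' c) |>.div_const 2
    have h3 := (((hasDerivAt_id x).sub_const c).pow 3).const_mul B |>.div_const 6
    have h := ((((hf x hx).sub_const (f c)).sub h1).sub h2).sub h3
    refine (h.congr_of_eventuallyEq (Filter.Eventually.of_forall fun y => ?_)).congr_deriv ?_
    · simp only [hg₀, Pi.sub_apply, Pi.pow_apply, id]
    · simp only [hg₁, id]; ring
  have hg₀anti : AntitoneOn g₀ (Icc c b) := by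
    refine antitoneOn_of_deriv_nonpos hD ?_ ?_ ?_
    · exact fun x hx => (hg₀d x hx).continuousAt.continuousWithinAt
    · intro x hx; rw [hint] at hx
      exact (hg₀d x (Ioo_subset_Icc_self hx)).differentiableAt.differentiableWithinAt
    · intro x hx; rw [hint] at hx
      rw [(hg₀d x (Ioo_subset_Icc_self hx)).deriv]
      exact hg₁le x (Ioo_subset_Icc_self hx)
  have := hg₀anti (left_mem_Icc.2 hcb) hx hx.1
  simp only [hg₀, sub_self, mul_zero] at this
  norm_num at this
  linarith

/-- **One-sided third-order Taylor bound (left of the centre).**  If `f, f', f''` have derivatives on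
`[a, c]` and `−B ≤ f'''` there, then `f x ≤ f c + f' c (x − c) + f'' c (x − c)²/2 + B (c − x)³/6` for
`x ∈ [a, c]`. [folklore] -/
theorem taylor3_upper_left {f f' f'' f''' : ℝ → ℝ} {a c B : ℝ} (hac : a ≤ c)
    (hf : ∀ x ∈ Icc a c, HasDerivAt f (f' x) x) (hf' : ∀ x ∈ Icc a c, HasDerivAt f' (f'' x) x)
    (hf'' : ∀ x ∈ Icc a c, HasDerivAt f'' (f''' x) x) (hB : ∀ x ∈ Icc a c, -B ≤ f''' x)
    {x : ℝ} (hx : x ∈ Icc a c) :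
    f x ≤ f c + f' c * (x - c) + f'' c * (x - c) ^ 2 / 2 + B * (c - x) ^ 3 / 6 := by
  -- reflect: F y = f (2c − y) on [c, 2c − a]
  have key := taylor3_upper_right (f := fun y => f (2 * c - y)) (f' := fun y => -f' (2 * c - y))
    (f'' := fun y => f'' (2 * c - y)) (f''' := fun y => -f''' (2 * c - y)) (c := c) (b := 2 * c - a)
    (B := B) (by linarith) ?_ ?_ ?_ ?_ (x := 2 * c - x) ⟨by linarith [hx.2], by linarith [hx.1]⟩
  · simp only [show 2 * c - (2 * c - x) = x by ring, show 2 * c - c = c by ring] at key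
    have e : (2 * c - x - c) = c - x := by ring
    rw [e] at key
    have e2 : (c - x) ^ 2 = (x - c) ^ 2 := by ring
    nlinarith [key]
  all_goals intro y hy
  · have hm : 2 * c - y ∈ Icc a c := ⟨by linarith [hy.2], by linarith [hy.1]⟩
    have hlin := (hasDerivAt_id y).const_sub (2 * c)
    have h := (hf (2 * c - y) hm).comp y hlin
    exact (h.congr_of_eventuallyEq (Filter.Eventually.of_forall fun z => by
      simp [Function.comp])).congr_deriv (by simp)
  · have hm : 2 * c - y ∈ Icc a c := ⟨by linarith [hy.2], by linarith [hy.1]⟩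
    have hlin := (hasDerivAt_id y).const_sub (2 * c)
    have h := ((hf' (2 * c - y) hm).comp y hlin).neg
    exact (h.congr_of_eventuallyEq (Filter.Eventually.of_forall fun z => by
      simp [Function.comp])).congr_deriv (by simp)
  · have hm : 2 * c - y ∈ Icc a c := ⟨by linarith [hy.2], by linarith [hy.1]⟩
    have hlin := (hasDerivAt_id y).const_sub (2 * c)
    have h := (hf'' (2 * c - y) hm).comp y hlin
    exact (h.congr_of_eventuallyEq (Filter.Eventually.of_forall fun z => by
      simp [Function.comp])).congr_deriv (by simp)
  · have hm : 2 * c - y ∈ Icc a c := ⟨by linarith [hy.2], by linarith [hy.1]⟩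
    linarith [hB (2 * c - y) hm]

end Summit.RiemannHypothesis.RiemannHypothesis.Theorems.IntegerScrew
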